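import Literature.Geometry.Lorentzian.SmoothDataFamilyLocal
import Literature.Geometry.Lorentzian.Hypersurface
import Literature.Geometry.Lorentzian.InitialData
import HarnessLib

/-!
# Patching an initial data set inside an open set; patched families are smooth families

Topic `Literature/Geometry/Lorentzian`. Plumbing for compactly supported deformations of initial
data sets on a FIXED manifold `X` (everything about the construction is PROVED; the only
definitions are the explicit patched field / datum). Let `D = (h, k)` be an initial data set on
`X`, `W ⊆ X` open, `C ⊆ W` closed (in `X`), and `(h₁, k₁)` fields of bilinear forms on the tangent
spaces of `X` which ON `W` are smooth, symmetric, `h₁` positive definite, and which AGREE with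
`(h, k)` on `W ∖ C`. Then

  `(D.patch P).h = h₁` on `W`,  `= h` elsewhere   (same for `k`)

is an initial data set on `X` (`InitialDataSet.patch`): near a point of `W` its sections are
`(h₁, k₁)`, near a point off `C` they are those of `D` (on `W ∖ C` the two prescriptions agree),
and `W ∪ Cᶜ = X`. For a parameter-dependent `(h₁(c), k₁(c))`, jointly smooth on `ℝᵐ × W` and
agreeing with `D` on `W ∖ C` for every `c`, the patched data form a smooth `m`-parameter family
(`InitialDataSet.isSmoothDataFamily_patch`, `IsSmoothDataFamily` of `Genericity.lean`).

This is the reassembly step of local deformation constructions: e.g. in step (iii) of the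
assembly of the named fact `ChruscielDelay_localConstraintDeformation`
(`LocalConstraintDeformation.lean`) the deformed data are produced on a coordinate ball `B`
(`W` = the chart domain, `C = B̄`) and must be re-read as a jointly smooth family of initial data
sets on `X` equal to `D` off `B̄`; what the new sections are and why they solve the constraints is
the user's business (the constraint functions only see germs, `InitialDataLocality.lean`). The
asymptotically flat instance (patching beyond a coordinate sphere of an end) is `AFEnd.patch`
(`AFEndPatch.lean`); this file is its interior analogue for an arbitrary open set.

* `InitialDataSet.patchField`, `patchField_of_mem`, `patchField_of_not_mem`,
  `patchField_eventuallyEq_of_mem`, `patchField_eventuallyEq_of_not_mem`, `contMDiff_patchField`;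
* `InitialDataSet.PatchData` (the hypotheses), `InitialDataSet.patch` and its section / germ
  lemmas; `patch_eq_self` (patching with `D`'s own sections gives `D` back);
* `InitialDataSet.isSmoothDataFamily_patch` — the family version; `contMDiffOn_patch_family` — the
  same over an open parameter set.

## References

* J. Corvino, *Scalar curvature deformation and a gluing construction for the Einstein constraint
  equations*, Comm. Math. Phys. 214 (2000), §4 (compactly supported deformations of data).
  [Corvino2000]
* R. Bartnik, J. Isenberg, *The constraint equations* (2004), §2. [BartnikIsenberg2004]
-/

noncomputable section

open Bundle Set Filter Function
open scoped Manifold ContDiff Topology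

namespace Literature.Geometry.Lorentzian

namespace InitialDataSet

variable {E : Type*} [NormedAddCommGroup E] [NormedSpace ℝ E] {H : Type*} [TopologicalSpace H]
  {I : ModelWithCorners ℝ E H} {X : Type*} [TopologicalSpace X] [ChartedSpace H X]

/-! ### The patched field -/

open scoped Classical in
/-- The patched field: `s₁` on `W`, `s` elsewhere. [folklore] -/
def patchField (W : Set X) (s₁ s : Π x : X, TangentSpace I x →L[ℝ] TangentSpace I x →L[ℝ] ℝ) :
    Π x : X, TangentSpace I x →L[ℝ] TangentSpace I x →L[ℝ] ℝ :=
  fun x ↦ if x ∈ W then s₁ x else s x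

variable {W C : Set X} {s₁ s : Π x : X, TangentSpace I x →L[ℝ] TangentSpace I x →L[ℝ] ℝ}

/-- On `W` the patched field is the new field. [folklore] -/
theorem patchField_of_mem {x : X} (hx : x ∈ W) : patchField (I := I) W s₁ s x = s₁ x := by
  classical
  exact if_pos hx

/-- Off `W` the patched field is the old field. [folklore] -/
theorem patchField_of_not_mem {x : X} (hx : x ∉ W) : patchField (I := I) W s₁ s x = s x := by
  classical
  exact if_neg hx

/-- Near a point of the open set `W` the patched field is the new field. [folklore] -/
theorem patchField_eventuallyEq_of_mem (hW : IsOpen W) {x : X} (hx : x ∈ W) :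
    ∀ᶠ y in 𝓝 x, patchField (I := I) W s₁ s y = s₁ y := by
  filter_upwards [hW.mem_nhds hx] with y hy
  exact patchField_of_mem hy

/-- **Near a point off the closed set `C` the patched field is the OLD field**, provided the two
fields agree on `W ∖ C`. [cite: Corvino2000, §4] -/
theorem patchField_eventuallyEq_of_not_mem (hC : IsClosed C)
    (hagree : ∀ y ∈ W, y ∉ C → s₁ y = s y) {x : X} (hx : x ∉ C) :
    ∀ᶠ y in 𝓝 x, patchField (I := I) W s₁ s y = s y := by
  filter_upwards [hC.isOpen_compl.mem_nhds hx] with y hy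
  by_cases hyW : y ∈ W
  · rw [patchField_of_mem hyW]
    exact hagree y hyW hy
  · exact patchField_of_not_mem hyW

variable [IsManifold I ∞ X]

/-- **Extensionality for initial data sets**, section form (the remaining fields are proofs;
`InitialDataSet.ext'` of `InitialDataPullback.lean` is the same with the forms evaluated on
vectors — not imported here to keep this plumbing file light). [folklore] -/
theorem ext_of_sections {D₁ D₂ : InitialDataSet I X} (hh : ∀ x, D₁.h.inner x = D₂.h.inner x)
    (hk : ∀ x, D₁.k x = D₂.k x) : D₁ = D₂ := by
  obtain ⟨⟨i₁, sy₁, p₁, b₁, c₁⟩, k₁', ks₁, kc₁⟩ := D₁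
  obtain ⟨⟨i₂, sy₂, p₂, b₂, c₂⟩, k₂', ks₂, kc₂⟩ := D₂
  have hi : i₁ = i₂ := funext hh
  have hk' : k₁' = k₂' := funext hk
  subst hi hk'
  rfl

/-- **The patched field is smooth** when the new field is smooth on the open set `W`, the old one
is smooth, and they agree on `W ∖ C` with `C ⊆ W` closed: every point has a neighbourhood on
which the patched field is one of the two (`W ∪ Cᶜ = X`). [cite: Corvino2000, §4] -/
theorem contMDiff_patchField (hW : IsOpen W) (hC : IsClosed C) (hCW : C ⊆ W)
    (hs₁ : ContMDiffOn I (I.prod 𝓘(ℝ, E →L[ℝ] E →L[ℝ] ℝ)) ∞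
      (fun x : X ↦ TotalSpace.mk' (E →L[ℝ] E →L[ℝ] ℝ)
        (E := fun x : X ↦ TangentSpace I x →L[ℝ] TangentSpace I x →L[ℝ] ℝ) x (s₁ x)) W)
    (hs : ContMDiff I (I.prod 𝓘(ℝ, E →L[ℝ] E →L[ℝ] ℝ)) ∞
      (fun x : X ↦ TotalSpace.mk' (E →L[ℝ] E →L[ℝ] ℝ)
        (E := fun x : X ↦ TangentSpace I x →L[ℝ] TangentSpace I x →L[ℝ] ℝ) x (s x)))
    (hagree : ∀ y ∈ W, y ∉ C → s₁ y = s y) :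
    ContMDiff I (I.prod 𝓘(ℝ, E →L[ℝ] E →L[ℝ] ℝ)) ∞
      (fun x : X ↦ TotalSpace.mk' (E →L[ℝ] E →L[ℝ] ℝ)
        (E := fun x : X ↦ TangentSpace I x →L[ℝ] TangentSpace I x →L[ℝ] ℝ) x
        (patchField (I := I) W s₁ s x)) := by
  intro x
  by_cases hx : x ∈ W
  · refine (hs₁.contMDiffAt (hW.mem_nhds hx)).congr_of_eventuallyEq ?_
    filter_upwards [patchField_eventuallyEq_of_mem (s₁ := s₁) (s := s) hW hx] with y hy
    rw [hy]
  · have hxC : x ∉ C := fun h ↦ hx (hCW h)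
    refine (hs x).congr_of_eventuallyEq ?_
    filter_upwards [patchField_eventuallyEq_of_not_mem (s₁ := s₁) (s := s) hC hagree hxC]
      with y hy
    rw [hy]

/-! ### The patched initial data set -/

/-- **The hypotheses of the patching construction**: `W` open, `C ⊆ W` closed; new sections
`(h₁, k₁)` which on `W` are smooth, symmetric, `h₁` positive definite, and which agree with `D`
on `W ∖ C`. [cite: Corvino2000, §4] -/
structure PatchData (D : InitialDataSet I X) (W C : Set X)
    (h₁ k₁ : Π x : X, TangentSpace I x →L[ℝ] TangentSpace I x →L[ℝ] ℝ) : Prop where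
  isOpen : IsOpen W
  isClosed : IsClosed C
  subset : C ⊆ W
  smooth_h : ContMDiffOn I (I.prod 𝓘(ℝ, E →L[ℝ] E →L[ℝ] ℝ)) ∞
    (fun x : X ↦ TotalSpace.mk' (E →L[ℝ] E →L[ℝ] ℝ)
      (E := fun x : X ↦ TangentSpace I x →L[ℝ] TangentSpace I x →L[ℝ] ℝ) x (h₁ x)) W
  smooth_k : ContMDiffOn I (I.prod 𝓘(ℝ, E →L[ℝ] E →L[ℝ] ℝ)) ∞
    (fun x : X ↦ TotalSpace.mk' (E →L[ℝ] E →L[ℝ] ℝ)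
      (E := fun x : X ↦ TangentSpace I x →L[ℝ] TangentSpace I x →L[ℝ] ℝ) x (k₁ x)) W
  symm_h : ∀ x ∈ W, ∀ v w, h₁ x v w = h₁ x w v
  pos_h : ∀ x ∈ W, ∀ v, v ≠ 0 → 0 < h₁ x v v
  symm_k : ∀ x ∈ W, ∀ v w, k₁ x v w = k₁ x w v
  agree_h : ∀ x ∈ W, x ∉ C → h₁ x = D.h.inner x
  agree_k : ∀ x ∈ W, x ∉ C → k₁ x = D.k x

variable [FiniteDimensional ℝ E] {D : InitialDataSet I X}
  {h₁ k₁ : Π x : X, TangentSpace I x →L[ℝ] TangentSpace I x →L[ℝ] ℝ}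

/-- **The patched initial data set** `D.patch P`: sections `(h₁, k₁)` on `W` and `(h, k)`
elsewhere, for patch data `P : D.PatchData W C h₁ k₁` (Corvino 2000, §4: compactly supported
deformations — the deformed data agree with the original ones off a compact set).
[cite: Corvino2000, §4] -/
def patch (D : InitialDataSet I X) (P : D.PatchData W C h₁ k₁) : InitialDataSet I X where
  h :=
    { inner := patchField (I := I) W h₁ D.h.inner
      symm := fun x v w ↦ by
        by_cases hx : x ∈ W
        · rw [patchField_of_mem hx]
          exact P.symm_h x hx v w
        · rw [patchField_of_not_mem hx]
          exact D.h.symm x v w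
      pos := fun x v hv ↦ by
        by_cases hx : x ∈ W
        · rw [patchField_of_mem hx]
          exact P.pos_h x hx v hv
        · rw [patchField_of_not_mem hx]
          exact D.h.pos x v hv
      isVonNBounded := fun x ↦ by
        by_cases hx : x ∈ W
        · have h := PseudoRiemannianMetric.IsSpacelikeImmersion.isVonNBounded_setOf_lt_one_of_pos
            (V := E) (show E →L[ℝ] E →L[ℝ] ℝ from h₁ x) (P.pos_h x hx)
          simp only [patchField_of_mem hx]
          exact h
        · simp only [patchField_of_not_mem hx]
          exact D.h.isVonNBounded x
      contMDiff := contMDiff_patchField P.isOpen P.isClosed P.subset P.smooth_h D.h.contMDiff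
        P.agree_h }
  k := patchField (I := I) W k₁ D.k
  k_symm x v w := by
    by_cases hx : x ∈ W
    · rw [patchField_of_mem hx]
      exact P.symm_k x hx v w
    · rw [patchField_of_not_mem hx]
      exact D.k_symm x v w
  contMDiff_k := contMDiff_patchField P.isOpen P.isClosed P.subset P.smooth_k D.contMDiff_k
    P.agree_k

variable (P : D.PatchData W C h₁ k₁)

/-- The metric of the patch on `W` is `h₁`. [cite: Corvino2000, §4] -/
theorem patch_h_inner_of_mem {x : X} (hx : x ∈ W) : (D.patch P).h.inner x = h₁ x :=
  patchField_of_mem hx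

/-- The tensor `k` of the patch on `W` is `k₁`. [cite: Corvino2000, §4] -/
theorem patch_k_of_mem {x : X} (hx : x ∈ W) : (D.patch P).k x = k₁ x :=
  patchField_of_mem hx

/-- The metric of the patch off `W` is `h`. [cite: Corvino2000, §4] -/
theorem patch_h_inner_of_not_mem {x : X} (hx : x ∉ W) : (D.patch P).h.inner x = D.h.inner x :=
  patchField_of_not_mem hx

/-- The tensor `k` of the patch off `W` is `k`. [cite: Corvino2000, §4] -/
theorem patch_k_of_not_mem {x : X} (hx : x ∉ W) : (D.patch P).k x = D.k x :=
  patchField_of_not_mem hx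

/-- Off `C` the metric of the patch is `h` (on `W ∖ C` the two prescriptions agree).
[cite: Corvino2000, §4] -/
theorem patch_h_inner_of_not_mem_closed {x : X} (hx : x ∉ C) :
    (D.patch P).h.inner x = D.h.inner x := by
  by_cases hxW : x ∈ W
  · rw [patch_h_inner_of_mem P hxW]
    exact P.agree_h x hxW hx
  · exact patch_h_inner_of_not_mem P hxW

/-- Off `C` the tensor `k` of the patch is `k`. [cite: Corvino2000, §4] -/
theorem patch_k_of_not_mem_closed {x : X} (hx : x ∉ C) : (D.patch P).k x = D.k x := by
  by_cases hxW : x ∈ W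
  · rw [patch_k_of_mem P hxW]
    exact P.agree_k x hxW hx
  · exact patch_k_of_not_mem P hxW

/-- **Germ of the patch at a point of `W`**: near `x ∈ W` the sections of the patch are
`(h₁, k₁)`. [cite: Corvino2000, §4] -/
theorem patch_eventuallyEq_of_mem {x : X} (hx : x ∈ W) :
    ∀ᶠ y in 𝓝 x, (D.patch P).h.inner y = h₁ y ∧ (D.patch P).k y = k₁ y := by
  filter_upwards [P.isOpen.mem_nhds hx] with y hy
  exact ⟨patch_h_inner_of_mem P hy, patch_k_of_mem P hy⟩

/-- **Germ of the patch at a point off `C`**: near `x ∉ C` the sections of the patch are those of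
`D`. [cite: Corvino2000, §4] -/
theorem patch_eventuallyEq_of_not_mem {x : X} (hx : x ∉ C) :
    ∀ᶠ y in 𝓝 x, (D.patch P).h.inner y = D.h.inner y ∧ (D.patch P).k y = D.k y := by
  filter_upwards [P.isClosed.isOpen_compl.mem_nhds hx] with y hy
  exact ⟨patch_h_inner_of_not_mem_closed P hy, patch_k_of_not_mem_closed P hy⟩

/-- **Patching with `D`'s own sections gives `D` back**: if `h₁ = h` and `k₁ = k` on `W` then
`D.patch P = D`. [folklore] -/
theorem patch_eq_self (hh : ∀ x ∈ W, h₁ x = D.h.inner x) (hk : ∀ x ∈ W, k₁ x = D.k x) :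
    D.patch P = D := by
  refine ext_of_sections (fun x ↦ ?_) (fun x ↦ ?_)
  · by_cases hx : x ∈ W
    · rw [patch_h_inner_of_mem P hx, hh x hx]
    · exact patch_h_inner_of_not_mem P hx
  · by_cases hx : x ∈ W
    · rw [patch_k_of_mem P hx, hk x hx]
    · exact patch_k_of_not_mem P hx

/-! ### Patched families are smooth families -/

/-- **A patched family is a smooth family.** Let `(h₁(c), k₁(c))`, `c ∈ ℝᵐ`, be patch data for
`D` on the same sets `W ⊇ C` for every `c`, JOINTLY smooth on `ℝᵐ × W`. Then
`c ↦ D.patch (P c)` is a smooth `m`-parameter family of initial data (`IsSmoothDataFamily`): near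
a point of `ℝᵐ × W` its section maps are `(c, x) ↦ h₁(c)(x)`, `k₁(c)(x)`, and near a point of
`ℝᵐ × Cᶜ` they are the constant ones of `D`. [cite: Corvino2000, §4] -/
theorem isSmoothDataFamily_patch {m : ℕ}
    {h₁ k₁ : EuclideanSpace ℝ (Fin m) → Π x : X, TangentSpace I x →L[ℝ] TangentSpace I x →L[ℝ] ℝ}
    (P : ∀ c, D.PatchData W C (h₁ c) (k₁ c)) (hW : IsOpen W) (hC : IsClosed C) (hCW : C ⊆ W)
    (hh : ContMDiffOn (𝓘(ℝ, EuclideanSpace ℝ (Fin m)).prod I) (I.prod 𝓘(ℝ, E →L[ℝ] E →L[ℝ] ℝ)) ∞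
      (fun q : EuclideanSpace ℝ (Fin m) × X ↦ TotalSpace.mk' (E →L[ℝ] E →L[ℝ] ℝ)
        (E := fun x : X ↦ TangentSpace I x →L[ℝ] TangentSpace I x →L[ℝ] ℝ) q.2 (h₁ q.1 q.2))
      (univ ×ˢ W))
    (hk : ContMDiffOn (𝓘(ℝ, EuclideanSpace ℝ (Fin m)).prod I) (I.prod 𝓘(ℝ, E →L[ℝ] E →L[ℝ] ℝ)) ∞
      (fun q : EuclideanSpace ℝ (Fin m) × X ↦ TotalSpace.mk' (E →L[ℝ] E →L[ℝ] ℝ)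
        (E := fun x : X ↦ TangentSpace I x →L[ℝ] TangentSpace I x →L[ℝ] ℝ) q.2 (k₁ q.1 q.2))
      (univ ×ˢ W)) :
    IsSmoothDataFamily m (fun c ↦ D.patch (P c)) := by
  rw [isSmoothDataFamily_iff_contMDiffAt]
  intro p
  by_cases hp : p.2 ∈ W
  · -- near a point over `W` the sections are `(h₁, k₁)`
    have hnhds : univ ×ˢ W ∈ 𝓝 p :=
      prod_mem_nhds univ_mem (hW.mem_nhds hp)
    have hev : ∀ᶠ q : EuclideanSpace ℝ (Fin m) × X in 𝓝 p, q.2 ∈ W :=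
      continuousAt_snd.preimage_mem_nhds (hW.mem_nhds hp)
    refine ⟨(hh.contMDiffAt hnhds).congr_of_eventuallyEq ?_,
      (hk.contMDiffAt hnhds).congr_of_eventuallyEq ?_⟩
    · filter_upwards [hev] with q hq
      simp only [patch_h_inner_of_mem (P q.1) hq]
    · filter_upwards [hev] with q hq
      simp only [patch_k_of_mem (P q.1) hq]
  · -- near a point over `Cᶜ` the sections are those of `D`
    have hpC : p.2 ∉ C := fun h ↦ hp (hCW h)
    have hev : ∀ᶠ q : EuclideanSpace ℝ (Fin m) × X in 𝓝 p, q.2 ∉ C :=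
      continuousAt_snd.preimage_mem_nhds (hC.isOpen_compl.mem_nhds hpC)
    have hconst := (isSmoothDataFamily_iff_contMDiffAt _).1 (isSmoothDataFamily_const m D) p
    refine ⟨hconst.1.congr_of_eventuallyEq ?_, hconst.2.congr_of_eventuallyEq ?_⟩
    · filter_upwards [hev] with q hq
      simp only [patch_h_inner_of_not_mem_closed (P q.1) hq]
    · filter_upwards [hev] with q hq
      simp only [patch_k_of_not_mem_closed (P q.1) hq]

/-- **A family patched over an open parameter set is smooth there.** As
`isSmoothDataFamily_patch`, with the joint smoothness of `(h₁(c), k₁(c))` only assumed on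
`N × W` for an open parameter set `N`: both section maps of `c ↦ D.patch (P c)` are `C^∞` on
`N × X` (the `ContMDiffOn` form in which local deformation statements are phrased).
[cite: Corvino2000, §4] -/
theorem contMDiffOn_patch_family {m : ℕ} {N : Set (EuclideanSpace ℝ (Fin m))} (hN : IsOpen N)
    {h₁ k₁ : EuclideanSpace ℝ (Fin m) → Π x : X, TangentSpace I x →L[ℝ] TangentSpace I x →L[ℝ] ℝ}
    (P : ∀ c, D.PatchData W C (h₁ c) (k₁ c)) (hW : IsOpen W) (hC : IsClosed C) (hCW : C ⊆ W)
    (hh : ContMDiffOn (𝓘(ℝ, EuclideanSpace ℝ (Fin m)).prod I) (I.prod 𝓘(ℝ, E →L[ℝ] E →L[ℝ] ℝ)) ∞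
      (fun q : EuclideanSpace ℝ (Fin m) × X ↦ TotalSpace.mk' (E →L[ℝ] E →L[ℝ] ℝ)
        (E := fun x : X ↦ TangentSpace I x →L[ℝ] TangentSpace I x →L[ℝ] ℝ) q.2 (h₁ q.1 q.2))
      (N ×ˢ W))
    (hk : ContMDiffOn (𝓘(ℝ, EuclideanSpace ℝ (Fin m)).prod I) (I.prod 𝓘(ℝ, E →L[ℝ] E →L[ℝ] ℝ)) ∞
      (fun q : EuclideanSpace ℝ (Fin m) × X ↦ TotalSpace.mk' (E →L[ℝ] E →L[ℝ] ℝ)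
        (E := fun x : X ↦ TangentSpace I x →L[ℝ] TangentSpace I x →L[ℝ] ℝ) q.2 (k₁ q.1 q.2))
      (N ×ˢ W)) :
    ContMDiffOn (𝓘(ℝ, EuclideanSpace ℝ (Fin m)).prod I) (I.prod 𝓘(ℝ, E →L[ℝ] E →L[ℝ] ℝ)) ∞
      (fun q : EuclideanSpace ℝ (Fin m) × X ↦ TotalSpace.mk' (E →L[ℝ] E →L[ℝ] ℝ)
        (E := fun x : X ↦ TangentSpace I x →L[ℝ] TangentSpace I x →L[ℝ] ℝ) q.2
        ((D.patch (P q.1)).h.inner q.2)) (N ×ˢ univ) ∧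
    ContMDiffOn (𝓘(ℝ, EuclideanSpace ℝ (Fin m)).prod I) (I.prod 𝓘(ℝ, E →L[ℝ] E →L[ℝ] ℝ)) ∞
      (fun q : EuclideanSpace ℝ (Fin m) × X ↦ TotalSpace.mk' (E →L[ℝ] E →L[ℝ] ℝ)
        (E := fun x : X ↦ TangentSpace I x →L[ℝ] TangentSpace I x →L[ℝ] ℝ) q.2
        ((D.patch (P q.1)).k q.2)) (N ×ˢ univ) := by
  have hconst := (isSmoothDataFamily_iff_contMDiffAt _).1 (isSmoothDataFamily_const m D)
  constructor
  · intro p hp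
    by_cases hpW : p.2 ∈ W
    · have hnhds : N ×ˢ W ∈ 𝓝 p := prod_mem_nhds (hN.mem_nhds hp.1) (hW.mem_nhds hpW)
      have hev : ∀ᶠ q : EuclideanSpace ℝ (Fin m) × X in 𝓝 p, q.2 ∈ W :=
        continuousAt_snd.preimage_mem_nhds (hW.mem_nhds hpW)
      refine ((hh.contMDiffAt hnhds).congr_of_eventuallyEq ?_).contMDiffWithinAt
      filter_upwards [hev] with q hq
      simp only [patch_h_inner_of_mem (P q.1) hq]
    · have hpC : p.2 ∉ C := fun h ↦ hpW (hCW h)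
      have hev : ∀ᶠ q : EuclideanSpace ℝ (Fin m) × X in 𝓝 p, q.2 ∉ C :=
        continuousAt_snd.preimage_mem_nhds (hC.isOpen_compl.mem_nhds hpC)
      refine ((hconst p).1.congr_of_eventuallyEq ?_).contMDiffWithinAt
      filter_upwards [hev] with q hq
      simp only [patch_h_inner_of_not_mem_closed (P q.1) hq]
  · intro p hp
    by_cases hpW : p.2 ∈ W
    · have hnhds : N ×ˢ W ∈ 𝓝 p := prod_mem_nhds (hN.mem_nhds hp.1) (hW.mem_nhds hpW)
      have hev : ∀ᶠ q : EuclideanSpace ℝ (Fin m) × X in 𝓝 p, q.2 ∈ W :=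
        continuousAt_snd.preimage_mem_nhds (hW.mem_nhds hpW)
      refine ((hk.contMDiffAt hnhds).congr_of_eventuallyEq ?_).contMDiffWithinAt
      filter_upwards [hev] with q hq
      simp only [patch_k_of_mem (P q.1) hq]
    · have hpC : p.2 ∉ C := fun h ↦ hpW (hCW h)
      have hev : ∀ᶠ q : EuclideanSpace ℝ (Fin m) × X in 𝓝 p, q.2 ∉ C :=
        continuousAt_snd.preimage_mem_nhds (hC.isOpen_compl.mem_nhds hpC)
      refine ((hconst p).2.congr_of_eventuallyEq ?_).contMDiffWithinAt
      filter_upwards [hev] with q hq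
      simp only [patch_k_of_not_mem_closed (P q.1) hq]

end InitialDataSet

end Literature.Geometry.Lorentzian

end
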